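import Summits.BirchSwinnertonDyer.BirchSwinnertonDyer.Theorems.SignedLowerHalvesSmallImageLowerHalfBothSignsRttEngineCMCurve
import Literature.NumberTheory.EllipticCurves.Rank1Residual.PeriodUnitProofs
import Literature.NumberTheory.EllipticCurves.SupersingularIrreducibleProofs
import Literature.NumberTheory.EllipticCurves.LeadingTermPPartProofs
import HarnessLib

/-!
# Route `SignedLowerHalves`, crux L `SmallImageLowerHalfBothSigns` (item stmt-BirchSwinnertonDyer-23599), line `rtt_w3` v3/v4:
# the engine ENG HOLDS FOR A UNIT CURVE PARTNER (tier «T1u») — from print BY NAME, with NO main-conjecture input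

Width seat `bsd-line-slh-p3-w3` g13 under LEAD `cruxlead-stmt-BirchSwinnertonDyer-23599` g2 (cell `bsd-ssimc`); ROUTE-INDEPENDENT
helper (`--supports stmt-BirchSwinnertonDyer-23599`); THEOREMS ONLY — no definition, no named fact, no `sorry`; closes nothing: the
registered ENG quantifies over EVERY level-matched partner; this file treats the partners `g = f_A` where `A/ℚ` is ANY elliptic
curve (CM or not), good at `p` with `a_p(A) = 0`, `A[p] ≃ W[p]` `Γ_ℚ`-equivariantly, whose `L`-VALUE `L(A,1)/Ω_A` IS A NON-ZERO
`p`-ADIC UNIT. BSD / crux L are NOT proved by this.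

WHY THIS TIER EXISTS (the LEAD's census, tiers T1/T2). The one-sided engine needs, at the partner, the inequality «analytic λ ≤
algebraic λ»: `λ(L^ε_A) ≤ λ(X^ε_A)`. Tier T1 (CM curve `A`) takes it from Pollack–Rubin 2004 (full ±-main conjecture); tier T2
(non-rational CM newform) has no printed source (M3≥). For a UNIT partner it is TRIVIAL: `L(A,1)/Ω_A ∈ ℤ_(p)ˣ` forces
`L^ε_p(A) ∈ Λˣ` for BOTH signs (Kobayashi (3.6): `L^ε(0) = c_ε·L(A,1)/Ω⁺_{f_A}`, `c_ε ∈ {2, p−1}`, and `Ω⁺_{f_A}/Ω_A ∈ ℤ_(p)ˣ` by the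
period-unit facts `h5`/`h3`), so `λ(L^ε_A) = 0 ≤ λ(X^ε_A)`. No CM, no Pollack–Rubin, no Selmer carrier for a newform. The k3-c4
census of crux 4 listed 7 such unit-partnered pairs among the 57 pairs WITHOUT a CM-curve partner (T2); every further rank-`0`
member of `W`'s mod-`p` congruence class with a unit `L`-value (Hesse pencil at `p = 3`, Fisher's families at `p = 5`) is one too.

THE THEOREM (`partnerLayerLambdaLower_of_unitCurvePartner`). `W/ℚ` good at the odd `p` with `a_p(W) = 0`; `A/ℚ` good at `p` with
`a_p(A) = 0`, `W[p] ≃ A[p]` `Γ_ℚ`-equivariantly, `g = f_A`, `ι : K_g → ℚ̄_p`, `Ω` a plus period of `g`, `f_A` with a Pollack pair,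
and `L(A,1)/Ω_A = t ∈ ℚˣ` with `ord_p t = 0`. GRANTED BY NAME Kobayashi Thm 1.2 (`h12`), B. D. Kim 2009 Cor 2.13 (λ) (`hKim`) and
the period units (`h5`, `h3`): for every cyclotomic `(κ, γ)`, finite `S₀ ∌ p` ⊇ bad(W) ∪ primes(N_A), and signed dual datum `D` of
`W` of sign `ε` (f.g., torsion, `μ = 0`), for all `n ≫ 0` of the parity of `ε`,
`λ_n(θ^{S₀}_n(g)^ι) ≤ deg ω_n^{−ε} + λ(X^ε_W) + Σ_{v∈S₀} δ_W^{(v)}` — ENG's body at this partner. Proof = the T1 engine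
(`partnerLayerLambdaLower_of_cmCurvePartner`, p745857) with its Pollack–Rubin step replaced by `λ(L^ε_A) = 0`: the `g`-side layer
element is `C(c)·θ^{S₀}_n(f_A)` (`exists_C_mul_map_mazurTateElementK`, `partnerEulerFactor_eq`), its layer-`λ` is
`deg ω_n^{−ε} + λ(L^ε_A) + Σδ_A = deg ω_n^{−ε} + Σδ_A` by the PROVED law AN_W for `A` (p744056), and `Σδ_A ≤ λ(X^ε_A) + Σδ_A =
λ(X^ε_W) + Σδ_W` by Kim's λ-transfer.

* §1 `isUnit_kobayashiL_of_lvalue_unit`, `lam_kobayashiL_eq_zero_of_lvalue_unit`, `hasUnitContent_kobayashiL_of_lvalue_unit` —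
  the unit case of Kobayashi (3.6) for a curve `A` good at odd `p` with `a_p = 0` (as in k3-c4x's `kobayashiMainConjecture_of_lvalue_unit`,
  here WITHOUT the small-image hypothesis and without any Selmer input).
* §2 ★ `partnerLayerLambdaLower_of_unitCurvePartner`.

References: [Kobayashi2003] (3.6) (p. 7), Thm. 1.2; [BDKim2009] Cor. 2.13; [GreenbergVatsal2000] §2 Prop. (2.4), §3 Rem. 3.4;
[Pollack2003] Prop. 6.18; [PollackWeston2011MT] §2.2 Def. 2.1, §3.1; [AbbesUllmo1996] Thm. A; [Mazur1978] Cor. 4.1.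
-/

set_option autoImplicit false
-- D-0017: single-problem summit, the namespace repeats the problem name by design.
set_option linter.dupNamespace false
noncomputable section

open scoped Classical MatrixGroups ModularForm BigOperators

open CongruenceSubgroup WeierstrassCurve Field Polynomial NumberField IsDedekindDomain
  Literature.NumberTheory.EllipticCurves Literature.NumberTheory.EllipticCurves.ModularForms
  Literature.NumberTheory.EllipticCurves.Rank1Residual
  Literature.NumberTheory.EllipticCurves.Kobayashi2003
  Literature.NumberTheory.EllipticCurves.GreenbergVatsal2000 ZpExtension
  Literature.NumberTheory.IwasawaTheory Rat.HeightOneSpectrum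
  Summit.BirchSwinnertonDyer.Rank1Residual.Supersingular
  Summit.BirchSwinnertonDyer.Rank1Residual.X1.MuLambda
  Summit.BirchSwinnertonDyer.Rank1Residual.X2.EulerFactorAlgebra
  Summit.BirchSwinnertonDyer.Rank1Residual.X2.EulerFactorInvariants

namespace Summit.BirchSwinnertonDyer.BirchSwinnertonDyer.Theorems.SmallImageRttOneSided

/-! ## §1 A unit `L`-value makes both signed `p`-adic `L`-functions units -/

section UnitValue

variable (A : WeierstrassCurve ℚ) [A.IsElliptic] [A.IsGloballyMinimal] (p : ℕ) [Fact p.Prime]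

/-- **The unit case of Kobayashi (3.6).** Let `A/ℚ` be globally minimal, good at the odd prime `p` with `a_p(A) = 0`, `g` its
newform (any level) with a Pollack pair `(L⁺, L⁻)`, and suppose `L(A,1)/Ω_A = t` is a non-zero rational `p`-adic unit. Then for
every sign `ε`, Kobayashi's `L^ε_p(A) ∈ Λˣ`: `L^ε(0) = c_ε·[0]⁺_g` (`IsPollackPair.constantCoeff_kobayashiL`, `p ∤ c_ε ∈ {2, p−1}`),
`[0]⁺_g = L(A,1)/Ω⁺_g = t·Ω_A/Ω⁺_g`, and `Ω_A/Ω⁺_g` is a `p`-adic unit by the period-unit facts (`h5` for `p ≥ 5`, `h3` for `p = 3`;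
`A[p]` is irreducible at a good supersingular prime). CONDITIONAL on `h5`/`h3` by name.
[cite: Kobayashi2003, (3.6) (p. 7)] [cite: GreenbergVatsal2000, §3, Remark 3.4] [cite: Mazur1978, Cor. 4.1] -/
theorem isUnit_kobayashiL_of_lvalue_unit
    (h5 : realPeriodRat_eq_unit_mul_plusPeriod) (h3 : realPeriodRat_eq_unit_mul_plusPeriod_three)
    (hp : p ≠ 2) (hgood : A.HasGoodReductionAtPrime p) (hap : A.frobeniusTrace p = 0)
    {N : ℕ} [NeZero N] {g : CuspForm (Gamma0 N) 2} (hg : IsNewformOf A g)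
    {Lplus Lminus : IwasawaAlgebra p} (hPP : IsPollackPair g p Lplus Lminus)
    {t : ℚ} (ht : A.entireLFunction 1 / (A.realPeriodRat : ℂ) = ((t : ℚ) : ℂ)) (ht0 : t ≠ 0)
    (hvt : padicValRat p t = 0) (ε : ℤˣ) : IsUnit (kobayashiL ε Lplus Lminus) := by
  have hpP : p.Prime := Fact.out
  set L := kobayashiL ε Lplus Lminus with hL_def
  -- irreducibility from supersingularity; a period ratio `ϖ` with `ϖ·Ω_A = Ω⁺_g`, a `p`-adic unit
  have hirr : A.HasIrreducibleModPGaloisRep p :=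
    hasIrreducibleModPGaloisRep_of_dvd_frobeniusTrace A p hp
      (A.not_dvd_minimalDiscriminantInt_of_hasGoodReductionAtPrime' p hgood) (by rw [hap]; exact dvd_zero _)
  have hϖex : ∃ ϖ : ℚ, (ϖ : ℝ) * A.realPeriodRat = plusPeriod g := by
    have hp35 : p = 3 ∨ 5 ≤ p := by
      by_cases hp3 : p = 3
      · exact Or.inl hp3
      · refine Or.inr ?_
        by_contra h
        have hlt : p < 5 := by omega
        have h2 := hpP.two_le
        interval_cases p
        · exact hp rfl
        · exact hp3 rfl
        · exact absurd hpP (by decide)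
    have hu : ∃ u : ℚ, ‖(u : ℚ_[p])‖ = 1 ∧ A.realPeriodRat = u * plusPeriod g := by
      rcases hp35 with hp3 | hp5
      · subst hp3
        exact h3 A hgood hirr g hg
      · exact h5 A p hp5 hgood hirr g hg
    obtain ⟨u, hu1, huΩ⟩ := hu
    have hu0 : u ≠ 0 := by
      rintro rfl
      simp at hu1
    refine ⟨u⁻¹, ?_⟩
    rw [huΩ]
    push_cast
    field_simp
  obtain ⟨ϖ, hϖ⟩ := hϖex
  have hvϖ : padicValRat p ϖ = 0 :=
    Rank1Residual.padicValRat_periodRatio_eq_zero h5 h3 A p hp hgood hirr g hg ϖ hϖ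
  have hϖ0 : ϖ ≠ 0 := by
    intro hz
    rw [hz, Rat.cast_zero, zero_mul] at hϖ
    exact (IsNewform0.plusPeriod_pos_holds hg.1 hg.coeffField_eq_bot).ne' hϖ.symm
  -- (3.6): `L(0) = c_ε · s`, `s = [0]⁺_g`, and `t = ϖ · s`
  have hLε := hPP.constantCoeff_kobayashiL hp hg hgood hap ε
  set s : ℚ := ratPlusSymbol g 0 with hs_def
  have hLval : A.entireLFunction 1 = (((s : ℝ) * plusPeriod g : ℝ) : ℂ) := hg.entireLFunction_one_eq
  have hts : t = ϖ * s := by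
    have h1 : A.entireLFunction 1 / (A.realPeriodRat : ℂ) = (((ϖ * s : ℚ) : ℝ) : ℂ) := by
      rw [hLval, ← hϖ, div_eq_iff (Complex.ofReal_ne_zero.mpr A.realPeriodRat_pos_holds.ne')]
      push_cast
      ring
    rw [ht] at h1
    exact_mod_cast h1
  have hs0 : s ≠ 0 := by
    intro hz
    exact ht0 (by rw [hts, hz, mul_zero])
  have hvs : padicValRat p s = 0 := by
    have := hvt
    rw [hts, padicValRat.mul hϖ0 hs0, hvϖ, zero_add] at this
    exact this
  -- `L(0)` is a `p`-adic unit, hence `L ∈ Λˣ`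
  have hcne : kobayashiConst p ε ≠ 0 := fun hz ↦
    not_dvd_kobayashiConst hp ε (by rw [hz]; exact dvd_zero p)
  have hc0 : (kobayashiConst p ε : ℚ_[p]) ≠ 0 := by exact_mod_cast hcne
  have hsQ0 : ((s : ℚ) : ℚ_[p]) ≠ 0 := by exact_mod_cast hs0
  have hL0ne : ((PowerSeries.constantCoeff L : ℤ_[p]) : ℚ_[p]) ≠ 0 := by
    rw [hLε]; exact mul_ne_zero hc0 hsQ0
  have hvL : (((PowerSeries.constantCoeff L : ℤ_[p]) : ℚ_[p])).valuation = 0 := by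
    rw [hLε, Padic.valuation_mul hc0 hsQ0, Padic.valuation_natCast,
      padicValNat.eq_zero_of_not_dvd (not_dvd_kobayashiConst hp ε), Padic.valuation_ratCast, hvs]
    simp
  have hnorm : ‖((PowerSeries.constantCoeff L : ℤ_[p]) : ℚ_[p])‖ = 1 := by
    rw [Padic.norm_eq_zpow_neg_valuation hL0ne, hvL, neg_zero, zpow_zero]
  have hunit0 : IsUnit (PowerSeries.constantCoeff L : ℤ_[p]) := PadicInt.isUnit_iff.mpr hnorm
  exact PowerSeries.isUnit_iff_constantCoeff.mpr hunit0

/-- **`λ(L^ε_p(A)) = 0` for both signs at a unit `L`-value** (`isUnit_kobayashiL_of_lvalue_unit` + `λ` of a unit of `Λ` is `0`).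
CONDITIONAL on `h5`/`h3` by name. [cite: Kobayashi2003, (3.6) (p. 7)] [cite: GreenbergVatsal2000, §3, Remark 3.4] -/
theorem lam_kobayashiL_eq_zero_of_lvalue_unit
    (h5 : realPeriodRat_eq_unit_mul_plusPeriod) (h3 : realPeriodRat_eq_unit_mul_plusPeriod_three)
    (hp : p ≠ 2) (hgood : A.HasGoodReductionAtPrime p) (hap : A.frobeniusTrace p = 0)
    {N : ℕ} [NeZero N] {g : CuspForm (Gamma0 N) 2} (hg : IsNewformOf A g)
    {Lplus Lminus : IwasawaAlgebra p} (hPP : IsPollackPair g p Lplus Lminus)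
    {t : ℚ} (ht : A.entireLFunction 1 / (A.realPeriodRat : ℂ) = ((t : ℚ) : ℂ)) (ht0 : t ≠ 0)
    (hvt : padicValRat p t = 0) (ε : ℤˣ) : lam (kobayashiL ε Lplus Lminus) = 0 :=
  Summit.BirchSwinnertonDyer.Rank1Residual.X1.ParitySqueeze.lam_eq_zero_of_isUnit
    (isUnit_kobayashiL_of_lvalue_unit A p h5 h3 hp hgood hap hg hPP ht ht0 hvt ε)

/-- **Unit content of `L^ε_p(A)` for both signs at a unit `L`-value** (the `0`-th coefficient is a unit) — the one-sign `μ`-floor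
of line `rtt_w3` AT THE PARTNER, for free. CONDITIONAL on `h5`/`h3` by name. [cite: Kobayashi2003, (3.6) (p. 7)]
[cite: Pollack2003, Conj. 6.3] -/
theorem hasUnitContent_kobayashiL_of_lvalue_unit
    (h5 : realPeriodRat_eq_unit_mul_plusPeriod) (h3 : realPeriodRat_eq_unit_mul_plusPeriod_three)
    (hp : p ≠ 2) (hgood : A.HasGoodReductionAtPrime p) (hap : A.frobeniusTrace p = 0)
    {N : ℕ} [NeZero N] {g : CuspForm (Gamma0 N) 2} (hg : IsNewformOf A g)
    {Lplus Lminus : IwasawaAlgebra p} (hPP : IsPollackPair g p Lplus Lminus)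
    {t : ℚ} (ht : A.entireLFunction 1 / (A.realPeriodRat : ℂ) = ((t : ℚ) : ℂ)) (ht0 : t ≠ 0)
    (hvt : padicValRat p t = 0) (ε : ℤˣ) : HasUnitContent (kobayashiL ε Lplus Lminus) := by
  have hu := isUnit_kobayashiL_of_lvalue_unit A p h5 h3 hp hgood hap hg hPP ht ht0 hvt ε
  exact ⟨0, by
    rw [PowerSeries.coeff_zero_eq_constantCoeff]
    exact PowerSeries.isUnit_iff_constantCoeff.mp hu⟩

end UnitValue

/-! ## §2 ENG for a unit curve partner -/

section UnitCurve

/-- ★ **The engine stub ENG of line `rtt_w3` HOLDS AT A UNIT CURVE PARTNER, from print by name — no main-conjecture input.** See the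
module docstring: for `W` good at the odd `p` with `a_p = 0`, a curve `A` good at `p` with `a_p(A) = 0`, `W[p] ≃ A[p]`
(`Γ_ℚ`-equivariant), its newform `g = f_A` with a Pollack pair, `ι`, a plus period `Ω`, and a non-zero `p`-adic unit `L`-value
`L(A,1)/Ω_A = t`; granted Kobayashi Thm 1.2 (`h12`), Kim 2009 Cor 2.13-λ (`hKim`) and the period units (`h5`, `h3`): for cyclotomic
`(κ,γ)`, finite `S₀ ∌ p` ⊇ bad(W) ∪ primes(N_A), and a signed dual datum `D` of `W` of sign `ε` (f.g., torsion, `μ = 0`), for all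
`n ≫ 0` of the parity of `ε`: `λ_n(θ^{S₀}_n(g)^ι) ≤ deg ω_n^{−ε} + λ(X^ε_W) + Σ_{v∈S₀} δ_W^{(v)}`. CONDITIONAL on the four named facts;
closes nothing. [cite: BDKim2009, Cor. 2.13] [cite: Kobayashi2003, Thm. 1.2, (3.6)] [cite: Pollack2003, Prop. 6.18]
[cite: GreenbergVatsal2000, §2 Prop. (2.4), §3 Rem. 3.4] -/
theorem partnerLayerLambdaLower_of_unitCurvePartner
    (h12 : thm12_signedSelmerDual_finite_torsion)
    (hKim : BDKim2009.cor213_signedLambda_add_sum_delta_eq_of_torsionIso)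
    (h5 : realPeriodRat_eq_unit_mul_plusPeriod) (h3 : realPeriodRat_eq_unit_mul_plusPeriod_three)
    (W A : WeierstrassCurve ℚ) [W.IsElliptic] [W.IsGloballyMinimal] [A.IsElliptic] [A.IsGloballyMinimal]
    (p : ℕ) [Fact p.Prime] (hp2 : p ≠ 2)
    (hgoodW : W.HasGoodReductionAtPrime p) (hapW : W.frobeniusTrace p = 0)
    (hgoodA : A.HasGoodReductionAtPrime p) (hapA : A.frobeniusTrace p = 0)
    (he : ∃ e : geomTorsion W (p : ℤ) ≃+ geomTorsion A (p : ℤ),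
      ∀ (σ : Field.absoluteGaloisGroup ℚ) (P : geomTorsion W (p : ℤ)), e (σ • P) = σ • e P)
    [NeZero (A.conductorNorm ℤ)] (g : CuspForm (Gamma0 (A.conductorNorm ℤ)) 2) (hg : IsNewformOf A g)
    (ι : coeffField g →+* PadicAlgCl p) (Ω : ℂ) (hΩ : IsPlusPeriod g Ω)
    (hPolA : ∃ Lp Lm : IwasawaAlgebra p, IsPollackPair g p Lp Lm)
    {t : ℚ} (ht : A.entireLFunction 1 / (A.realPeriodRat : ℂ) = ((t : ℚ) : ℂ)) (ht0 : t ≠ 0)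
    (hvt : padicValRat p t = 0)
    (ε : ℤˣ) (κ : ZpExtension ℚ p) (γ : absoluteGaloisGroup ℚ) (hκ : κ.IsCyclotomic) (hγ : κ.IsTopGenerator γ)
    (S₀ : Finset (HeightOneSpectrum (𝓞 ℚ))) (hS₀p : ∀ v ∈ S₀, ((p : ℕ) : 𝓞 ℚ) ∉ v.asIdeal)
    (hS₀W : ∀ v : HeightOneSpectrum (𝓞 ℚ), ¬ W.HasGoodReductionAt v → v ∈ S₀)
    (hS₀A : ∀ v : HeightOneSpectrum (𝓞 ℚ), natGenerator v ∣ A.conductorNorm ℤ → v ∈ S₀)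
    (D : SignedSelmerDualData W κ γ ε) [Module.Finite (IwasawaAlgebra p) D.X]
    (hXt : Module.IsTorsion (IwasawaAlgebra p) D.X) (hμ : D.mu = 0) :
    ∃ n₀ : ℕ, ∀ n ≥ n₀, (Even n ↔ ε = 1) →
      ((layerLambda (((mazurTateElementK g Ω p n).map ι *
              ∏ v ∈ S₀, (1 - C (embCoeff g ι (natGenerator v)) * X +
                  (if natGenerator v ∣ A.conductorNorm ℤ then 0 else C (natGenerator v : PadicAlgCl p)) * X ^ 2).comp
                (C ((natGenerator v : PadicAlgCl p)⁻¹) *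
                  (X + 1) ^ (PadicInt.toZModPow n (-(frobeniusExponent p (natGenerator v : ℤ_[p])))).val)) %ₘ
              ((X + 1) ^ p ^ n - 1)) : ℕ) : ℤ) ≤
        ((if ε = 1 then cyclotomicOmegaMinus p n else cyclotomicOmegaPlus p n).natDegree : ℤ) + ((lambdaInvariant p D.X : ℕ) : ℤ) + ((∑ v ∈ S₀, delta W p v : ℕ) : ℤ) := by
  obtain ⟨Lp, Lm, hPPA⟩ := hPolA
  -- (1) AN_W for `A`
  have hS' : ∀ v ∈ S₀, natGenerator v ≠ p := fun v hv ↦ natGenerator_ne_of_natCast_not_mem v (hS₀p v hv)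
  obtain ⟨n₁, hn₁⟩ :=
    Summit.BirchSwinnertonDyer.BirchSwinnertonDyer.Theorems.SmallImageRttLayerLaw.eventually_layerLambda_depleted_of_isPollackPair
      A hp2 g hPPA ε S₀ hS'
  -- (2) the unit `L`-value: `λ(L^ε_A) = 0`
  have hlamA : lam (kobayashiL ε Lp Lm) = 0 :=
    lam_kobayashiL_eq_zero_of_lvalue_unit A p h5 h3 hp2 hgoodA hapA hg hPPA ht ht0 hvt ε
  -- (3) Kim's λ-transfer `W ↔ A` (a signed dual datum of `A`, f.g. torsion by Kobayashi Thm 1.2)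
  obtain ⟨DA⟩ := Kobayashi2003.nonempty_signedSelmerDualData (W := A) (κ := κ) (ε := ε) hγ
  haveI : Module.Finite (IwasawaAlgebra p) DA.X := h12.moduleFinite hp2 hgoodA hapA hκ hγ DA
  have hXtA : Module.IsTorsion (IwasawaAlgebra p) DA.X := h12.isTorsion hp2 hgoodA hapA hκ hγ DA
  have hS₀A' : ∀ v : HeightOneSpectrum (𝓞 ℚ), ¬ A.HasGoodReductionAt v → v ∈ S₀ := fun v hv ↦
    hS₀A v ((WeierstrassCurve.dvd_conductorNorm_iff A v).mpr hv)
  have hKimW := hKim W A p hp2 hgoodW hapW hgoodA hapA he κ γ hκ hγ S₀ hS₀p hS₀W hS₀A' ε D DA hXt hXtA hμ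
  -- (4) the `g`-side layer element is `C(c)·` the `A`-side one
  obtain ⟨c, hc0, hθ⟩ := exists_C_mul_map_mazurTateElementK hg.1 hg.coeffField_eq_bot hΩ ι
  have hfac : ∀ v : HeightOneSpectrum (𝓞 ℚ), ∀ n : ℕ, (1 - C (embCoeff g ι (natGenerator v)) * X +
                  (if natGenerator v ∣ A.conductorNorm ℤ then 0 else C (natGenerator v : PadicAlgCl p)) * X ^ 2).comp
                (C ((natGenerator v : PadicAlgCl p)⁻¹) *
                  (X + 1) ^ (PadicInt.toZModPow n (-(frobeniusExponent p (natGenerator v : ℤ_[p])))).val) =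
              ((A.localPolynomialAt v).map (Int.castRingHom (PadicAlgCl p))).comp
                (C ((natGenerator v : PadicAlgCl p)⁻¹) *
                  (X + 1) ^ (PadicInt.toZModPow n (-(frobeniusExponent p (natGenerator v : ℤ_[p])))).val) := by
    intro v n
    rw [partnerEulerFactor_eq A hg ι v]
  refine ⟨n₁, fun n hn hpar ↦ ?_⟩
  have h1 := hn₁ n hn hpar
  have hrew : (((mazurTateElementK g Ω p n).map ι *
              ∏ v ∈ S₀, (1 - C (embCoeff g ι (natGenerator v)) * X +
                  (if natGenerator v ∣ A.conductorNorm ℤ then 0 else C (natGenerator v : PadicAlgCl p)) * X ^ 2).comp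
                (C ((natGenerator v : PadicAlgCl p)⁻¹) *
                  (X + 1) ^ (PadicInt.toZModPow n (-(frobeniusExponent p (natGenerator v : ℤ_[p])))).val)) %ₘ
              ((X + 1) ^ p ^ n - 1)) =
      C c * (((mazurTateElement g p n).map (algebraMap ℚ (PadicAlgCl p)) *
              ∏ v ∈ S₀, ((A.localPolynomialAt v).map (Int.castRingHom (PadicAlgCl p))).comp
                (C ((natGenerator v : PadicAlgCl p)⁻¹) *
                  (X + 1) ^ (PadicInt.toZModPow n (-(frobeniusExponent p (natGenerator v : ℤ_[p])))).val)) %ₘ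
              ((X + 1) ^ p ^ n - 1)) := by
    rw [hθ n, Finset.prod_congr rfl (fun v _ ↦ hfac v n), mul_assoc, C_mul', smul_modByMonic, ← C_mul']
  rw [hrew, Summit.BirchSwinnertonDyer.BirchSwinnertonDyer.Theorems.ResidualThetaLayer.layerLambda_C_mul hc0, h1, hlamA]
  have hK' : ((lambdaInvariant p D.X : ℕ) : ℤ) + ((∑ v ∈ S₀, delta W p v : ℕ) : ℤ) =
      ((lambdaInvariant p DA.X : ℕ) : ℤ) + ((∑ v ∈ S₀, delta A p v : ℕ) : ℤ) := by
    exact_mod_cast hKimW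
  have hnn : (0 : ℤ) ≤ ((lambdaInvariant p DA.X : ℕ) : ℤ) := by exact_mod_cast Nat.zero_le _
  push_cast [Nat.cast_add] at hK' ⊢
  omega

end UnitCurve

end Summit.BirchSwinnertonDyer.BirchSwinnertonDyer.Theorems.SmallImageRttOneSided

end
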